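import Summits.Ventures.HodgeRepro2.T5DoublingBlock
import Summits.Ventures.HodgeRepro2.T5UnitaryBound

/-!
# T5ParabolicBlocks — the block-matrix bookkeeping of the CLAIM of (N4.3.P1), kernel-checked

Support for `route/T5-N4-p5.md` (sub-step N4.3 = (R3)), step (N4.3.P1), CLAIM
«`|a(i(g,1))| = det((1 + g g*)/2)^{−1/2}`».  The printed proof writes the doubled space as
`W_n = Y_n ⊕ Y_n^∇` (`Y_n = {(w, w)}`, `Y_n^∇ = {(w, −w)}`), an element `x ∈ G(W_n)` in blocks
`x = [[A, B], [C, D]]`, the Siegel parabolic as `P(Y_n) = {C = 0}` with `D_p = (a*)⁻¹` for the Levi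
block `a = A_p`, the maximal compact `K` through a majorant (`k k* = 1`), and reads off
`|a(x)|⁻² = det(C C* + D D*)` from the bottom block row `(C D) = (0 D_p) k` of `x = p k`; for
`x = i(g, 1)` the blocks are `A = D = (g + 1)/2`, `B = C = (g − 1)/2`.  Every step is elementary
block-matrix algebra, for square blocks of ANY size `n`:

* `doubling_eq_conj`: the blocks of `(g, 1)` in the basis `Y ⊕ Y^∇` — `½ P · diag(g, 1) · P =
  fromBlocks ((g+1)/2) ((g−1)/2) ((g−1)/2) ((g+1)/2)` with `P = fromBlocks 1 1 1 (−1)`, `P⁻¹ = ½ P`;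
* `parabolic_relations`: `p = fromBlocks A B 0 D` preserving the pairing `formH = fromBlocks 0 1 1 0`
  has `Aᴴ D = 1` (so `D = (Aᴴ)⁻¹`) and `Dᴴ B + Bᴴ D = 0`; `norm_det_mul`: `‖det A‖ · ‖det D‖ = 1`;
* `bottom_row_identity`: for `x = p k` with `k kᴴ = 1`, `C′ C′ᴴ + D′ D′ᴴ = D Dᴴ` (bottom blocks of `x`);
* `normSq_det_levi`: if `doubling g = p k` as above then `normSq (det A_p)⁻¹ = det(½(1 + g gᴴ))` —
  the CLAIM's identity `|a(i(g,1))|⁻² = det((1 + g g*)/2)`; for `n = Fin 2` this is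
  `T5UnitaryBound.Delta g` (`normSq_det_levi_eq_Delta`), whose bound `Δ ≥ 1` / equality case are
  `T5UnitaryBound.one_le_Delta_re` / `Delta_eq_one_iff_mem_unitaryGroup`.

Honest scope: the factorisation `x = p k` itself (the Iwasawa decomposition `G(W_n) = P(Y_n) K`),
the identification of the majorant `h_K` and of the standard section are NOT formalised — they are
the hypotheses `hk`, `hp`, `hx` of `normSq_det_levi`.
-/

noncomputable section

namespace Summit.Ventures.HodgeRepro2.T5ParabolicBlocks

open Matrix

variable {n : Type*} [Fintype n] [DecidableEq n]

/-- The form pairing the two Lagrangians `Y` and `Y^∇`: `fromBlocks 0 1 1 0`. -/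
def formH : Matrix (n ⊕ n) (n ⊕ n) ℂ := fromBlocks 0 1 1 0

/-- The block matrix of `(g, 1)` in the basis `Y ⊕ Y^∇`:
`fromBlocks ((g+1)/2) ((g−1)/2) ((g−1)/2) ((g+1)/2)`. -/
def doubling (g : Matrix n n ℂ) : Matrix (n ⊕ n) (n ⊕ n) ℂ :=
  fromBlocks ((1 / 2 : ℂ) • (g + 1)) ((1 / 2 : ℂ) • (g - 1)) ((1 / 2 : ℂ) • (g - 1))
    ((1 / 2 : ℂ) • (g + 1))

/-- The basis change `P = fromBlocks 1 1 1 (−1)` squares to `2`: `P⁻¹ = ½ P`. -/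
theorem basisChange_mul_self :
    fromBlocks (1 : Matrix n n ℂ) 1 1 (-1) * fromBlocks 1 1 1 (-1) = (2 : ℂ) • (1 : Matrix (n ⊕ n) (n ⊕ n) ℂ) := by
  rw [fromBlocks_multiply, ← fromBlocks_one, fromBlocks_smul]
  simp only [Matrix.mul_one, Matrix.mul_neg, neg_neg, add_neg_cancel, smul_zero, fromBlocks_inj]
  refine ⟨?_, trivial, trivial, ?_⟩ <;> · ext i j; simp [Matrix.one_apply]; split_ifs <;> norm_num

/-- `(g, 1) = diag(g, 1)` on `W ⊕ W` becomes `doubling g` in the basis `Y ⊕ Y^∇`: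
`½ · P · diag(g, 1) · P = doubling g`. -/
theorem doubling_eq_conj (g : Matrix n n ℂ) :
    (1 / 2 : ℂ) • (fromBlocks (1 : Matrix n n ℂ) 1 1 (-1) * fromBlocks g 0 0 1 *
      fromBlocks 1 1 1 (-1)) = doubling g := by
  unfold doubling
  rw [fromBlocks_multiply, fromBlocks_multiply, fromBlocks_smul, fromBlocks_inj]
  refine ⟨?_, ?_, ?_, ?_⟩ <;> congr 1 <;>
    simp only [Matrix.mul_one, Matrix.one_mul, Matrix.mul_zero, Matrix.mul_neg, add_zero, zero_add,
      neg_neg, sub_eq_add_neg]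

/-- THE PARABOLIC RELATIONS: `p = fromBlocks A B 0 D` preserving `formH` (`pᴴ H p = H`) has
`Aᴴ D = 1`, `Dᴴ A = 1` and `Dᴴ B + Bᴴ D = 0`. -/
theorem parabolic_relations (A B D : Matrix n n ℂ)
    (h : (fromBlocks A B 0 D)ᴴ * formH * fromBlocks A B 0 D = formH) :
    Aᴴ * D = 1 ∧ Dᴴ * A = 1 ∧ Dᴴ * B + Bᴴ * D = 0 := by
  unfold formH at h
  rw [fromBlocks_conjTranspose, fromBlocks_multiply, fromBlocks_multiply] at h
  simp only [Matrix.mul_one, Matrix.mul_zero, Matrix.zero_mul, add_zero, zero_add,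
    conjTranspose_zero, fromBlocks_inj] at h
  exact ⟨h.2.1, h.2.2.1, h.2.2.2⟩

/-- `‖det A‖ · ‖det D‖ = 1` when `Aᴴ D = 1`. -/
theorem norm_det_mul (A D : Matrix n n ℂ) (h : Aᴴ * D = 1) : ‖A.det‖ * ‖D.det‖ = 1 := by
  have h1 := congrArg Matrix.det h
  rw [det_mul, det_conjTranspose, det_one, Complex.star_def] at h1
  have h2 := congrArg norm h1
  rwa [norm_mul, Complex.norm_conj, norm_one] at h2

/-- `normSq (det A) · normSq (det D) = 1` when `Aᴴ D = 1`. -/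
theorem normSq_det_mul (A D : Matrix n n ℂ) (h : Aᴴ * D = 1) :
    Complex.normSq A.det * Complex.normSq D.det = 1 := by
  have := norm_det_mul A D h
  rw [Complex.normSq_eq_norm_sq, Complex.normSq_eq_norm_sq, ← mul_pow, this, one_pow]

/-- The `(2,2)` block of `k kᴴ = 1`: `K₂₁ K₂₁ᴴ + K₂₂ K₂₂ᴴ = 1`. -/
theorem block22_of_unitary (k : Matrix (n ⊕ n) (n ⊕ n) ℂ) (hk : k * kᴴ = 1) :
    k.toBlocks₂₁ * k.toBlocks₂₁ᴴ + k.toBlocks₂₂ * k.toBlocks₂₂ᴴ = 1 := by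
  rw [← fromBlocks_toBlocks k, fromBlocks_conjTranspose, fromBlocks_multiply, ← fromBlocks_one,
    fromBlocks_inj] at hk
  exact hk.2.2.2

/-- THE BOTTOM BLOCK ROW of `x = p k` (`p = fromBlocks A B 0 D`, `k kᴴ = 1`):
`C′ C′ᴴ + D′ D′ᴴ = D Dᴴ` for the bottom blocks `C′ = x.toBlocks₂₁`, `D′ = x.toBlocks₂₂`. -/
theorem bottom_row_identity (A B D : Matrix n n ℂ) (k : Matrix (n ⊕ n) (n ⊕ n) ℂ) (hk : k * kᴴ = 1) :
    (fromBlocks A B 0 D * k).toBlocks₂₁ * (fromBlocks A B 0 D * k).toBlocks₂₁ᴴ +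
      (fromBlocks A B 0 D * k).toBlocks₂₂ * (fromBlocks A B 0 D * k).toBlocks₂₂ᴴ = D * Dᴴ := by
  have h22 := block22_of_unitary k hk
  conv_lhs => rw [← fromBlocks_toBlocks k]
  rw [fromBlocks_multiply, toBlocks_fromBlocks₂₁, toBlocks_fromBlocks₂₂]
  simp only [Matrix.zero_mul, zero_add, conjTranspose_mul]
  calc D * k.toBlocks₂₁ * (k.toBlocks₂₁ᴴ * Dᴴ) + D * k.toBlocks₂₂ * (k.toBlocks₂₂ᴴ * Dᴴ)
      = D * (k.toBlocks₂₁ * k.toBlocks₂₁ᴴ + k.toBlocks₂₂ * k.toBlocks₂₂ᴴ) * Dᴴ := by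
        simp only [Matrix.mul_add, Matrix.add_mul, Matrix.mul_assoc]
    _ = D * Dᴴ := by rw [h22, Matrix.mul_one]

/-- `det (D Dᴴ) = normSq (det D)`. -/
theorem det_mul_conjTranspose (D : Matrix n n ℂ) :
    (D * Dᴴ).det = (Complex.normSq D.det : ℂ) := by
  rw [det_mul, det_conjTranspose, Complex.star_def, Complex.mul_conj]

/-- The bottom blocks of `doubling g` are `(g − 1)/2` and `(g + 1)/2`, and
`C′ C′ᴴ + D′ D′ᴴ = ½(1 + g gᴴ)` (`T5DoublingBlock.halves_block_identity`). -/
theorem doubling_bottom_identity (g : Matrix n n ℂ) :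
    (doubling g).toBlocks₂₁ * (doubling g).toBlocks₂₁ᴴ +
      (doubling g).toBlocks₂₂ * (doubling g).toBlocks₂₂ᴴ = (1 / 2 : ℂ) • (1 + g * gᴴ) := by
  unfold doubling
  rw [toBlocks_fromBlocks₂₁, toBlocks_fromBlocks₂₂]
  exact T5DoublingBlock.halves_block_identity g

/-- THE CLAIM'S BOOKKEEPING: if `doubling g = p k` with `p = fromBlocks A B 0 D ∈ P(Y)` preserving
`formH` and `k kᴴ = 1`, then `normSq (det A)⁻¹ = det (½(1 + g gᴴ))`, i.e.
`|a(i(g,1))|⁻² = det((1 + g g*)/2)` for the Levi block `a = A` of `p`. -/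
theorem normSq_det_levi (g A B D : Matrix n n ℂ) (k : Matrix (n ⊕ n) (n ⊕ n) ℂ) (hk : k * kᴴ = 1)
    (hp : (fromBlocks A B 0 D)ᴴ * formH * fromBlocks A B 0 D = formH)
    (hx : doubling g = fromBlocks A B 0 D * k) :
    ((Complex.normSq A.det)⁻¹ : ℂ) = ((1 / 2 : ℂ) • (1 + g * gᴴ)).det := by
  have hAD := (parabolic_relations A B D hp).1
  have hnorm := normSq_det_mul A D hAD
  have hA : Complex.normSq A.det ≠ 0 := by
    intro h0; rw [h0, zero_mul] at hnorm; exact zero_ne_one hnorm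
  have hD : Complex.normSq D.det = (Complex.normSq A.det)⁻¹ := by
    field_simp
    linear_combination hnorm
  rw [← doubling_bottom_identity, hx, bottom_row_identity A B D k hk, det_mul_conjTranspose, hD]
  push_cast
  rfl

/-- For `n = Fin 2` the right-hand side is `T5UnitaryBound.Delta g`. -/
theorem normSq_det_levi_eq_Delta (g A B D : Matrix (Fin 2) (Fin 2) ℂ)
    (k : Matrix (Fin 2 ⊕ Fin 2) (Fin 2 ⊕ Fin 2) ℂ) (hk : k * kᴴ = 1)
    (hp : (fromBlocks A B 0 D)ᴴ * formH * fromBlocks A B 0 D = formH)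
    (hx : doubling g = fromBlocks A B 0 D * k) :
    ((Complex.normSq A.det)⁻¹ : ℂ) = T5UnitaryBound.Delta g :=
  normSq_det_levi g A B D k hk hp hx

/-! ### v2 (append-only): `|a(x)|` is well defined — `P(Y) ∩ K = {fromBlocks A 0 0 A : A unitary}`

The text's parenthesis «well defined: `K ∩ P(Y_n)` acts on `Y_n` unitarily»: if `x = p k = p′ k′` then
`p′⁻¹ p = k′ k⁻¹ ∈ P(Y) ∩ K`, and such an element is `fromBlocks A 0 0 A` with `A` unitary, so
`‖det a_p‖ = ‖det a_{p′}‖`. -/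

open scoped ComplexOrder

/-- `P(Y) ∩ K`: a block-upper-triangular `p = fromBlocks A B 0 D` that preserves `formH` and is
unitary (`p pᴴ = 1`) has `A` unitary, `D = A` and `B = 0`. -/
theorem parabolic_unitary (A B D : Matrix n n ℂ)
    (hp : (fromBlocks A B 0 D)ᴴ * formH * fromBlocks A B 0 D = formH)
    (hu : fromBlocks A B 0 D * (fromBlocks A B 0 D)ᴴ = 1) :
    A * Aᴴ = 1 ∧ D = A ∧ B = 0 := by
  obtain ⟨hAD, -, -⟩ := parabolic_relations A B D hp
  rw [fromBlocks_conjTranspose, fromBlocks_multiply, ← fromBlocks_one, fromBlocks_inj] at hu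
  simp only [Matrix.zero_mul, Matrix.mul_zero, zero_add, conjTranspose_zero] at hu
  obtain ⟨h11, -, -, h22⟩ := hu
  -- `D Dᴴ = 1 ⇒ Dᴴ D = 1`, and `Aᴴ D = 1 ⇒ Aᴴ = Dᴴ ⇒ A = D`.
  have hDD : Dᴴ * D = 1 := mul_eq_one_comm.mp h22
  have hAeq : Aᴴ = Dᴴ := by
    calc Aᴴ = Aᴴ * (D * Dᴴ) := by rw [h22, Matrix.mul_one]
      _ = (Aᴴ * D) * Dᴴ := by rw [Matrix.mul_assoc]
      _ = Dᴴ := by rw [hAD, Matrix.one_mul]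
  have hDA : D = A := by
    have := congrArg conjTranspose hAeq
    rw [conjTranspose_conjTranspose, conjTranspose_conjTranspose] at this
    exact this.symm
  have hAA : A * Aᴴ = 1 := by rw [← hDA]; exact h22
  refine ⟨hAA, hDA, ?_⟩
  have hBB : B * Bᴴ = 0 := by
    have := h11
    rw [hAA] at this
    -- `1 + B Bᴴ = 1`
    exact add_left_cancel (a := (1 : Matrix n n ℂ)) (by rw [this, add_zero])
  exact Matrix.self_mul_conjTranspose_eq_zero.mp hBB

/-- The Levi block of an element of `P(Y) ∩ K` has `‖det A‖ = 1`. -/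
theorem norm_det_levi_eq_one_of_unitary (A : Matrix n n ℂ) (hA : A * Aᴴ = 1) : ‖A.det‖ = 1 := by
  have h := congrArg Matrix.det hA
  rw [det_mul_conjTranspose, det_one] at h
  have h' : Complex.normSq A.det = 1 := by exact_mod_cast h
  rw [Complex.normSq_eq_norm_sq] at h'
  nlinarith [norm_nonneg A.det]

/-- The inverse of `p = fromBlocks A B 0 D` with `Aᴴ D = 1`: `fromBlocks Dᴴ (−Dᴴ B Aᴴ) 0 Aᴴ`. -/
theorem parabolic_mul_inv (A B D : Matrix n n ℂ) (hAD : Aᴴ * D = 1) :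
    fromBlocks A B 0 D * fromBlocks Dᴴ (-(Dᴴ * B * Aᴴ)) 0 Aᴴ = 1 := by
  have hDA : Dᴴ * A = 1 := by
    have := congrArg conjTranspose hAD
    rwa [conjTranspose_mul, conjTranspose_conjTranspose, conjTranspose_one] at this
  have hADh : A * Dᴴ = 1 := mul_eq_one_comm.mp hDA
  have hDAh : D * Aᴴ = 1 := mul_eq_one_comm.mp hAD
  rw [fromBlocks_multiply, ← fromBlocks_one, fromBlocks_inj]
  refine ⟨?_, ?_, ?_, ?_⟩
  · rw [hADh, Matrix.mul_zero, add_zero]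
  · rw [Matrix.mul_neg, ← Matrix.mul_assoc, ← Matrix.mul_assoc, hADh, Matrix.one_mul,
      neg_add_cancel]
  · rw [Matrix.zero_mul, Matrix.mul_zero, add_zero]
  · rw [Matrix.zero_mul, zero_add, hDAh]

/-- Form-preservation passes to products. -/
theorem preserves_formH_mul (x y : Matrix (n ⊕ n) (n ⊕ n) ℂ) (hx : xᴴ * formH * x = formH)
    (hy : yᴴ * formH * y = formH) : (x * y)ᴴ * formH * (x * y) = formH := by
  rw [conjTranspose_mul]
  calc yᴴ * xᴴ * formH * (x * y) = yᴴ * (xᴴ * formH * x) * y := by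
        simp only [Matrix.mul_assoc]
    _ = formH := by rw [hx, hy]

/-- Form-preservation passes to a two-sided inverse. -/
theorem preserves_formH_inv (x q : Matrix (n ⊕ n) (n ⊕ n) ℂ) (hx : xᴴ * formH * x = formH)
    (hxq : x * q = 1) : qᴴ * formH * q = formH := by
  have hqx : q * x = 1 := mul_eq_one_comm.mp hxq
  have hqxh : xᴴ * qᴴ = 1 := by
    have := congrArg conjTranspose hqx
    rwa [conjTranspose_mul, conjTranspose_one] at this
  calc qᴴ * formH * q = qᴴ * (xᴴ * formH * x) * q := by rw [hx]
    _ = (qᴴ * xᴴ) * formH * (x * q) := by simp only [Matrix.mul_assoc]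
    _ = formH := by
        rw [hxq, Matrix.mul_one]
        have : qᴴ * xᴴ = 1 := by
          have := congrArg conjTranspose hxq
          rwa [conjTranspose_mul, conjTranspose_one] at this
        rw [this, Matrix.one_mul]

/-- WELL-DEFINEDNESS OF `|a(x)|`: if `p k = p′ k′` with `p = fromBlocks A B 0 D`,
`p′ = fromBlocks A′ B′ 0 D′` both preserving `formH`, and `k, k′` unitary, then
`‖det A‖ = ‖det A′‖` (form-preservation of `k, k′` is not even needed). -/
theorem norm_det_levi_well_defined (A B D A' B' D' : Matrix n n ℂ)
    (k k' : Matrix (n ⊕ n) (n ⊕ n) ℂ)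
    (hp : (fromBlocks A B 0 D)ᴴ * formH * fromBlocks A B 0 D = formH)
    (hp' : (fromBlocks A' B' 0 D')ᴴ * formH * fromBlocks A' B' 0 D' = formH)
    (hk : k * kᴴ = 1) (hk' : k' * k'ᴴ = 1)
    (hx : fromBlocks A B 0 D * k = fromBlocks A' B' 0 D' * k') :
    ‖A.det‖ = ‖A'.det‖ := by
  obtain ⟨hAD', -, -⟩ := parabolic_relations A' B' D' hp'
  -- `q := p′⁻¹ p = k′ k⁻¹ = k′ kᴴ` lies in `P(Y) ∩ K`.
  set q := fromBlocks D'ᴴ (-(D'ᴴ * B' * A'ᴴ)) 0 A'ᴴ * fromBlocks A B 0 D with hq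
  have hinv := parabolic_mul_inv A' B' D' hAD'
  have hq' : q = k' * kᴴ := by
    have h1 : fromBlocks D'ᴴ (-(D'ᴴ * B' * A'ᴴ)) 0 A'ᴴ * fromBlocks A' B' 0 D' = 1 :=
      mul_eq_one_comm.mp hinv
    calc q = q * (k * kᴴ) := by rw [hk, Matrix.mul_one]
      _ = fromBlocks D'ᴴ (-(D'ᴴ * B' * A'ᴴ)) 0 A'ᴴ * (fromBlocks A B 0 D * k) * kᴴ := by
          rw [hq]; simp only [Matrix.mul_assoc]
      _ = fromBlocks D'ᴴ (-(D'ᴴ * B' * A'ᴴ)) 0 A'ᴴ * (fromBlocks A' B' 0 D' * k') * kᴴ := by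
          rw [hx]
      _ = k' * kᴴ := by rw [← Matrix.mul_assoc, h1, Matrix.one_mul]
  -- its blocks
  have hqblocks : q = fromBlocks (D'ᴴ * A) (D'ᴴ * B + -(D'ᴴ * B' * A'ᴴ) * D) 0 (A'ᴴ * D) := by
    rw [hq, fromBlocks_multiply]
    simp only [Matrix.mul_zero, Matrix.zero_mul, add_zero, zero_add]
  -- `q` preserves `formH` and is unitary
  have hqH : qᴴ * formH * q = formH := by
    rw [hq]
    exact preserves_formH_mul _ _ (preserves_formH_inv _ _ hp' hinv) hp
  have hqU : q * qᴴ = 1 := by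
    rw [hq', conjTranspose_mul, conjTranspose_conjTranspose]
    calc k' * kᴴ * (k * k'ᴴ) = k' * (kᴴ * k) * k'ᴴ := by simp only [Matrix.mul_assoc]
      _ = 1 := by rw [mul_eq_one_comm.mp hk, Matrix.mul_one, hk']
  rw [hqblocks] at hqH hqU
  obtain ⟨hLevi, -, -⟩ := parabolic_unitary _ _ _ hqH hqU
  -- `‖det (D′ᴴ A)‖ = 1` and `‖det A′‖ ‖det D′‖ = 1`
  have h1 := norm_det_levi_eq_one_of_unitary _ hLevi
  rw [det_mul, det_conjTranspose, norm_mul, Complex.star_def, Complex.norm_conj] at h1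
  have h2 := norm_det_mul A' D' hAD'
  have hD'pos : ‖D'.det‖ ≠ 0 := by
    intro h0; rw [h0, mul_zero] at h2; exact zero_ne_one h2
  apply mul_left_cancel₀ hD'pos
  rw [h1, mul_comm, h2]

end Summit.Ventures.HodgeRepro2.T5ParabolicBlocks

end
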